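/-
Copyright: cell `pub-ymgap` (HUMAN RULING D-0062), Track A of `YM-PLAN.md`, DAG node N20 (= NE7b); R134 acceleration seat
`pub-ymgap-dag-n20-c` (strategy s1, generation 8), module 44.  Released under the licence of the surrounding project.
-/
import Summits.QuantumFields.YangMills.Theorems.BalabanUVNodesN20LCSHullSeparation
import HarnessLib

/-!
# YM-DAG node N20 (= NE7b), row s1, module 44: THE HULL OF WINDOW-ADMISSIBLE PINS LIES IN THE ACCUMULATED SMALL-FIELD REGION —
# every plaquette the repaired display integrates sits, with all four corners, inside `Λ_{k+1} ⊆ Λ_i ⊆ Ω_i` (`1 ≤ i ≤ k+1`) of the history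

Track A of `YM-PLAN.md` (cell `pub-ymgap`, HUMAN RULING D-0062), node **N20** = spine estimate NE7b (`T4WeightBudget.RelWeightBound`, NOT
PRINTED, NOT PROVED).  Seat `pub-ymgap-dag-n20-c` (R134, s1 «the first missing estimate»), generation 8, module 44 (imports module 42
`…N20LCSHullSeparation`).  Kernel theorems only: 0 `def`, 0 `sorry`, standard axioms; COUNT-NEUTRAL.  Lattice geometry over node00-def-T's layer
algebra and n22-b's (2.1)-chains BY NAME; it asserts nothing of Bałaban's.

WHY.  Module 42 separated the repaired display's plaquette sets `X` (box-hulls of the regularity regions of window cubes `c″ ∈ D ⊆ cubes32 (k+1) σ`,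
`σ = seqOfHist (k+1) h`) from the previous step's regularity regions (module 38's forcing), and module 43 named the regime.  THIS FILE records the
positive half of the same layer calculus — WHERE those `X` live: since a window cube lies in `(Z̃_{k+1}^{∼4})ᶜ` and `Z̃^{∼4} ⊇` four 𝐃_{k+2}-layers around
`Z_{k+1} = Λ_{k+1}ᶜ`, every fine point within `4·sideD (k+1)` (coordinatewise) of a window cube lies in `Λ_{k+1}` (§1); hence, under the budget
`(r (k+1) + 1)·sideχ (k+1) + L^{k+1}·(ρ + 1) ≤ 4·sideD (k+1) + 1` (implied by module 42's nesting letter, §2), the fine positions of ALL FOUR CORNERS of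
every plaquette of an admissible `X` lie in `Λ_{k+1}(t)` — and therefore, by the (2.1)-chain `Λ_{k+1} ⊆ Ω_{k+1} ⊆ Λ_k ⊆ ⋯ ⊆ Λ_1 ⊆ Ω_1`, in EVERY
small-field region `Λ_i` and every localization domain `Ω_i` of the history (§3–§4).  That is the precise sense of «localised to its small-field window»
in the repaired wall «LCS-j on the hull of window-admissible pins»: the exponential moment is asked only of plaquettes in the region where the term
carries no large-field operation at ANY level ([Balaban1988Convergent] p. 258: *«The last large field region is Z_k, and 𝐓_k is supported in it, in
the sense that it involves integrations and variables restricted to this region»*) — the region of print's small-field bounds, where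
[Balaban1989LargeFieldII] p. 383 gets *«the factors exp O(1)|Z_j ∩ Ω_j|»* from *«the positivity properties of the quadratic forms»*.

* §1 `not_mem_Zreg_of_near_W32` (`y ∈ W32 k s`, `coordDist u y ≤ 4·sideD k` coordinatewise, `0 < sideD` ⇒ `u ∉ Z_k`), `mem_Λ_succ_of_near_W32` (along `σ s t`:
  `u ∈ Λ_{k+1}(t) = (σ s t).Λ (k+1)`), ★ `mem_Λ_succ_of_collar` (points within `ρ′` of the `r₂`-collar of a window cube, budget `(r₂+1)·sideχ (k+1) + ρ′ ≤
  4·sideD (k+1) + 1`).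
* §2 `shift_apply'`, `coordDist_embIter_shift_le` (a lattice step at scale `j` moves the fine position by `≤ L^j` per coordinate), ★ `corner_mem_Λ_succ_of_mem_boxRegion`
  (all four corners of `q ∈ boxRegion (emb p′.src) ρ`, `p′` local to a window cube), `budget_of_nesting` (module 42's nesting letter ⇒ this file's
  budget, `1 ≤ M₂`).
* §3 ★★★ `corners_mem_Λ_labelAt` — AT THE DISPLAY: for every history `h : Fin (k+1) → LabelPat`, `D ⊆ cubes32 (k+1) (seqOfHist (k+1) h)`, admissible `X`
  (module 40 §3's sense, radius `ρ`), LOCALITY of `R (k+1)`: every corner of every `q ∈ X` has fine position in `(seqOfHist (k+1) h).Λ (k+1)`.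
* §4 ★★★ `corners_mem_Λ_Ω_of_le` — … hence in `(seqOfHist (k+1) h).Λ i` and `(seqOfHist (k+1) h).Ω i` for every `1 ≤ i ≤ k+1` (n22-b's `Chain21.Λ_antitone`,
  `Λ_subset_Ω_of_le`).

HONEST FRAMING.  Combinatorial geometry of the torus of record; no estimate.  The LOCALITY letter on `R`, `hreg`, «LCS-j on the hull of window-admissible
pins» ((A1c), THE wall), the reading and the 𝐑-step stay displayed as in modules 40 ∕ 41 ∕ 42.  NE7b NOT PRINTED ∕ NOT PROVED; (α)-instance 0∕1; N20 NOT
discharged; typed 28∕28, discharged count untouched; one finite four-torus at fixed `ε` — NOT ℝ⁴, NOT infinite volume, NOT OS, NOT a mass gap, NOT Clay.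

References (LOCATORS): T. Bałaban, CMP 119 (1988) 243–285 [Balaban1988Convergent] ((2.1) p. 254, p. 258 (support of `𝐓_k` in `Z_k`), (3.2)–(3.5)
p. 264–265, (3.20) p. 269); CMP 122 (1989) 355–392 [Balaban1989LargeFieldII] (p. 383 l. 21–28); CMP 109 (1987) 249–301 [Balaban1987RG1] ((0.1) p. 251).
-/

set_option autoImplicit false

noncomputable section

namespace Summit.QuantumFields.YangMills.BalabanUVNodes.N20LCSHullInSmallField

open Literature.MathematicalPhysics.QuantumFieldTheory.Balaban1983to89
open Literature.MathematicalPhysics.QuantumFieldTheory.Balaban1983to89.T4Continuum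
open Literature.MathematicalPhysics.QuantumFieldTheory.Balaban1983to89.B14.Eq218Concrete
open Literature.MathematicalPhysics.QuantumFieldTheory.Balaban1983to89.Node00
open Literature.MathematicalPhysics.QuantumFieldTheory.Balaban1983to89.B15DeterminingSets (embIter)
open Literature.MathematicalPhysics.QuantumFieldTheory.Balaban1983to89.B15Claim189CubePin
  (cubeOfSite cubeOfSite_mem_cubeIndices mem_cubeEnl_cubeOfSite)
open Literature.MathematicalPhysics.QuantumFieldTheory.Balaban1983to89.B15Claim189LambdaPin
  (coordDist mem_cubeEnl_cubeOfSite_of_near subset_hullD)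
open Literature.MathematicalPhysics.QuantumFieldTheory.Balaban1983to89.B14SeparationOfRecord (mem_hullD_iff one_le_RkOfRecord)
open Summit.QuantumFields.YangMills.BalabanUVNodes.N20LCSAvgDominationRegion (boxRegion mem_boxRegion)
open Summit.QuantumFields.YangMills.BalabanUVNodes.N20LCSLabelTower
open Summit.QuantumFields.YangMills.BalabanUVNodes.N20LCSHullSeparation
  (coordDist_triangle coordDist_lt_of_mem_cubeEnl coordDist_embIter_le_of_eq_add coordDist_embIter_le_of_mem_boxRegion
    cubeχ_subset_W32_of_mem_cubes32 sideD_pos_of_pos)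

/-! ## §1 Fine points near the window lie in the new small-field region `Λ_{k+1}` -/

section NearWindow

variable (F : T4Family) (ν : Stage7Numerics) (M : ℕ) (p : B12.RunParams) (g : ℕ → ℝ)

/-- **WITHIN FOUR 𝐃-LAYERS OF THE WINDOW THERE IS NO LARGE FIELD**: if `y ∈ W32 k s = (Z̃_k^{∼4})ᶜ` and `u` is within `4·sideD k` of `y` in every coordinate, then
`u ∉ Z_k` (else the 4-collar of the 𝐃-cube of `y` would meet `hullD 0 Z_k ∋ u`, putting `y` in `Z̃_k^{∼4}`). [cite: Balaban1988Convergent, p.264–265 («four layers of the LMR_{k+1}-cubes»)] -/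
theorem not_mem_Zreg_of_near_W32 {k : ℕ} (hD : 0 < sideD F ν M p g k) (s : SeqOfRecord F ν M g p.K k) {y u : Site (F.P p.K) 0}
    (hy : y ∈ W32 F ν M p g k s) (hnear : ∀ i, coordDist u y i ≤ 4 * sideD F ν M p g k) : u ∉ Zreg F ν M p g k s := by
  intro hu
  have huH : u ∈ hullD (F.P p.K) (sideD F ν M p g k) 0 (Zreg F ν M p g k s) := subset_hullD hD 0 _ hu
  have huC : u ∈ cubeEnl (F.P p.K) (sideD F ν M p g k) (cubeOfSite (sideD F ν M p g k) y) 4 :=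
    mem_cubeEnl_cubeOfSite_of_near hD hnear
  exact hy (mem_hullD_iff.2 ⟨cubeOfSite (sideD F ν M p g k) y, cubeOfSite_mem_cubeIndices _ hD y, ⟨u, huC, huH⟩,
    mem_cubeEnl_cubeOfSite _ hD y⟩)

/-- **… ALONG `σ s t` THAT IS MEMBERSHIP IN `Λ_{k+1}(t)`**: `Z_{k+1} = Λ_{k+1}(t)ᶜ` for the appended pair, so a fine point within `4·sideD (k+1)` of the window
`W32 (k+1) (σ s t)` lies in `(σ s t).Λ (k+1) = Λ_{k+1}(t)`. [cite: Balaban1988Convergent, (2.3) p.255, (3.20) p.269, p.264–265] -/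
theorem mem_Λ_succ_of_near_W32 {k : ℕ} (hD : 0 < sideD F ν M p g (k + 1)) (s : SeqOfRecord F ν M g p.K k) (t : LbOfRecord F ν p g k)
    {y u : Site (F.P p.K) 0} (hy : y ∈ W32 F ν M p g (k + 1) (σOfRecord F ν M p g k s t))
    (hnear : ∀ i, coordDist u y i ≤ 4 * sideD F ν M p g (k + 1)) : u ∈ (σOfRecord F ν M p g k s t).Λ (k + 1) := by
  have h := not_mem_Zreg_of_near_W32 F ν M p g hD _ hy hnear
  rw [Zreg, if_pos (Nat.succ_le_succ (Nat.zero_le k)), Set.mem_compl_iff, not_not] at h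
  exact h

/-- ★ **THE COLLARS OF WINDOW CUBES LIE IN `Λ_{k+1}(t)`**: a fine point `u` within `ρ′` (coordinatewise) of a point `w` of the `r₂`-collar of a window cube
`c″ ∈ cubes32 (k+1) (σ s t)` lies in `(σ s t).Λ (k+1)`, provided `(r₂ + 1)·sideχ (k+1) + ρ′ ≤ 4·sideD (k+1) + 1` and `0 < sideD (k+1)`.
[cite: Balaban1988Convergent, (3.2) p.265, (3.20) p.269, p.264–265] -/
theorem mem_Λ_succ_of_collar {k : ℕ} (hD : 0 < sideD F ν M p g (k + 1)) (s : SeqOfRecord F ν M g p.K k) (t : LbOfRecord F ν p g k)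
    {c'' : Iχ F ν p g (k + 1)} (hc'' : c'' ∈ cubes32 F ν M p g (k + 1) (σOfRecord F ν M p g k s t)) {r₂ ρ' : ℕ}
    {w u : Site (F.P p.K) 0} (hw : w ∈ cubeEnl (F.P p.K) (sideχ F ν p g (k + 1)) c'' r₂) (hu : ∀ i, coordDist u w i ≤ ρ')
    (hbud : (r₂ + 1) * sideχ F ν p g (k + 1) + ρ' ≤ 4 * sideD F ν M p g (k + 1) + 1) :
    u ∈ (σOfRecord F ν M p g k s t).Λ (k + 1) := by
  obtain ⟨y, hy⟩ := cubeEnl_zero_nonempty (F.P p.K) (sideχ F ν p g (k + 1)) c''.2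
  have hyW := cubeχ_subset_W32_of_mem_cubes32 F ν M p g _ hc'' hy
  refine mem_Λ_succ_of_near_W32 F ν M p g hD s t hyW fun i => ?_
  have h1 : coordDist w y i < (r₂ + 0 + 1) * sideχ F ν p g (k + 1) := coordDist_lt_of_mem_cubeEnl hw hy i
  have h2 := coordDist_triangle u w y i
  have h3 := hu i
  rw [Nat.add_zero] at h1
  omega

end NearWindow

/-! ## §2 Plaquette corners: one lattice step at scale `j` costs `L^j` fine steps; the corners of admissible plaquettes lie in `Λ_{k+1}` -/

section Corners

variable {P : Params}

/-- Coordinates of a shifted site at any scale: `(x + e_μ) i` is `x i + 1` for `i = μ` and `x i` otherwise (dag-n12-e's `shift_apply`, every `j`).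
[cite: Balaban1985Averaging, (5) p.18 (bookkeeping)] -/
theorem shift_apply' {j : ℕ} (x : Site P j) (μ i : Fin P.d) : (x.shift μ) i = if i = μ then x i + 1 else x i := by
  unfold Site.shift
  by_cases h : i = μ
  · subst h; simp
  · simp [h]

/-- **ONE LATTICE STEP AT SCALE `j` MOVES THE FINE POSITION BY AT MOST `L^j` PER COORDINATE** (`x + e_μ` has label `x_μ + 1` in direction `μ` and the same labels
elsewhere; module 42's `coordDist_embIter_le_of_eq_add`). [cite: Balaban1987RG1, (0.1) p.251–252] -/
theorem coordDist_embIter_shift_le {j : ℕ} (hj : j ≤ P.m + P.K) (x : Site P j) (μ ν : Fin P.d) :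
    coordDist (embIter j (x.shift μ)) (embIter j x) ν ≤ P.L ^ j := by
  have h : (x.shift μ) ν = x ν + ((if ν = μ then (1 : ℤ) else 0 : ℤ) : ZMod (P.sitesPerDir j)) := by
    rw [shift_apply']
    by_cases hνμ : ν = μ
    · rw [if_pos hνμ, if_pos hνμ]; push_cast; rfl
    · rw [if_neg hνμ, if_neg hνμ]; push_cast; simp
  refine (coordDist_embIter_le_of_eq_add hj h).trans ?_
  split_ifs <;> simp

variable (F : T4Family) (ν : Stage7Numerics) (M : ℕ) (p : B12.RunParams) (g : ℕ → ℝ)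

/-- ★ **ALL FOUR CORNERS OF AN ADMISSIBLE PLAQUETTE LIE IN `Λ_{k+1}(t)`.**  Along `σ s t`, let `c″ ∈ cubes32 (k+1) (σ s t)` carry a level-`(k+2)` plaquette `p′`
whose fine position `embIter (k+2) p′.src` is within `r₂` χ_{k+2}-layers of `c″`, and let `q ∈ boxRegion (emb p′.src) ρ` (scale `k+1 ≤ m + K`).  Under the budget
`(r₂+1)·sideχ (k+1) + L^{k+1}·(ρ+1) ≤ 4·sideD (k+1) + 1` and `0 < sideD (k+1)`, the fine positions of `q.src`, `q.src + e_μ`, `q.src + e_ν`, `q.src + e_μ + e_ν`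
all lie in `(σ s t).Λ (k+1)`. [cite: Balaban1988Convergent, (3.2) p.265, (3.20) p.269, p.264–265; Balaban1987RG1, (0.1) p.251] -/
theorem corner_mem_Λ_succ_of_mem_boxRegion {k : ℕ} (hk : k + 1 ≤ (F.P p.K).m + (F.P p.K).K) (hD : 0 < sideD F ν M p g (k + 1))
    (s : SeqOfRecord F ν M g p.K k) (t : LbOfRecord F ν p g k)
    {c'' : Iχ F ν p g (k + 1)} (hc'' : c'' ∈ cubes32 F ν M p g (k + 1) (σOfRecord F ν M p g k s t)) {r₂ ρ : ℕ}
    {p' : Plaq (F.P p.K) (k + 2)} (hp' : embIter (k + 2) p'.src ∈ cubeEnl (F.P p.K) (sideχ F ν p g (k + 1)) c'' r₂)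
    {q : Plaq (F.P p.K) (k + 1)} (hq : q ∈ boxRegion (emb p'.src) ρ)
    (hbud : (r₂ + 1) * sideχ F ν p g (k + 1) + (F.P p.K).L ^ (k + 1) * (ρ + 1) ≤ 4 * sideD F ν M p g (k + 1) + 1)
    {z : Site (F.P p.K) (k + 1)} (hz : z = q.src ∨ z = q.src.shift q.μ ∨ z = q.src.shift q.ν ∨ z = (q.src.shift q.μ).shift q.ν) :
    embIter (k + 1) z ∈ (σOfRecord F ν M p g k s t).Λ (k + 1) := by
  refine mem_Λ_succ_of_collar F ν M p g hD s t hc'' hp' (ρ' := (F.P p.K).L ^ (k + 1) * (ρ + 1)) (fun i => ?_) hbud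
  -- the corner is within `L^{k+1}` (twice, for the far corner) of the source, the source within `L^{k+1}·ρ` of `emb p′.src`
  have hsrc : coordDist (embIter (k + 1) q.src) (embIter (k + 2) p'.src) i ≤ (F.P p.K).L ^ (k + 1) * ρ :=
    coordDist_embIter_le_of_mem_boxRegion hk hq i
  have h := coordDist_triangle (embIter (k + 1) z) (embIter (k + 1) q.src) (embIter (k + 2) p'.src) i
  -- a corner differs from the source by at most ONE step in each coordinate (the two steps are in distinct directions)
  have hz1 : coordDist (embIter (k + 1) z) (embIter (k + 1) q.src) i ≤ (F.P p.K).L ^ (k + 1) := by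
    rcases hz with rfl | rfl | rfl | rfl
    · rw [B15Claim189LambdaPin.coordDist_self]; exact Nat.zero_le _
    · exact coordDist_embIter_shift_le hk q.src q.μ i
    · exact coordDist_embIter_shift_le hk q.src q.ν i
    · -- the far corner: in coordinate `i` only one of the two shifts acts (`μ ≠ ν`)
      have hne : q.μ ≠ q.ν := ne_of_lt q.hμν
      have key : ((q.src.shift q.μ).shift q.ν) i = q.src i + ((if i = q.μ ∨ i = q.ν then (1 : ℤ) else 0 : ℤ) : ZMod ((F.P p.K).sitesPerDir (k + 1))) := by
        rw [shift_apply', shift_apply']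
        by_cases hiν : i = q.ν
        · have hiμ : i ≠ q.μ := fun h' => hne (h'.symm.trans hiν)
          rw [if_pos hiν, if_neg hiμ, if_pos (Or.inr hiν)]; push_cast; rfl
        · by_cases hiμ : i = q.μ
          · rw [if_neg hiν, if_pos hiμ, if_pos (Or.inl hiμ)]; push_cast; rfl
          · rw [if_neg hiν, if_neg hiμ, if_neg (not_or.2 ⟨hiμ, hiν⟩)]; push_cast; simp
      refine (coordDist_embIter_le_of_eq_add hk key).trans ?_
      split_ifs <;> simp
  calc coordDist (embIter (k + 1) z) (embIter (k + 2) p'.src) i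
      ≤ (F.P p.K).L ^ (k + 1) + (F.P p.K).L ^ (k + 1) * ρ := h.trans (Nat.add_le_add hz1 hsrc)
    _ = (F.P p.K).L ^ (k + 1) * (ρ + 1) := by ring

/-- **MODULE 42's NESTING LETTER IMPLIES THIS FILE's BUDGET** (`1 ≤ M₂`: the dropped term `(r₁+1)·sideχ k ≥ L^{k+2} ≥ L^{k+1} + 1`).
[cite: Balaban1988Convergent, p.245, (2.17) p.257 (bookkeeping)] -/
theorem budget_of_nesting (hM₂ : 1 ≤ ν.M₂) {k r₁ r₂ ρ : ℕ}
    (hnum : (r₁ + 1) * sideχ F ν p g k + (F.P p.K).L ^ (k + 1) * ρ + (r₂ + 1) * sideχ F ν p g (k + 1) ≤ 4 * sideD F ν M p g (k + 1) + 2) :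
    (r₂ + 1) * sideχ F ν p g (k + 1) + (F.P p.K).L ^ (k + 1) * (ρ + 1) ≤ 4 * sideD F ν M p g (k + 1) + 1 := by
  have hL : 2 ≤ (F.P p.K).L := (F.P p.K).hL.2
  have hR : 1 ≤ RkOfRecord (F.P p.K).L ν.r (g (k + 1)) := one_le_RkOfRecord (F.P p.K).L_pos _ _
  have hpow : 1 ≤ (F.P p.K).L ^ (k + 1) := Nat.one_le_pow _ _ (F.P p.K).L_pos
  have hχ : (F.P p.K).L ^ (k + 1) + 1 ≤ sideχ F ν p g k := by
    have e : sideχ F ν p g k = (F.P p.K).L ^ (k + 1) * ((F.P p.K).L * ν.M₂ * RkOfRecord (F.P p.K).L ν.r (g (k + 1))) := by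
      simp only [sideχ, cubeSide]; ring
    rw [e]
    have h2 : 2 ≤ (F.P p.K).L * ν.M₂ * RkOfRecord (F.P p.K).L ν.r (g (k + 1)) := by
      calc 2 ≤ (F.P p.K).L * 1 * 1 := by omega
        _ ≤ _ := Nat.mul_le_mul (Nat.mul_le_mul_left _ hM₂) hR
    nlinarith
  have h1 : sideχ F ν p g k ≤ (r₁ + 1) * sideχ F ν p g k := Nat.le_mul_of_pos_left _ (Nat.succ_pos _)
  nlinarith

end Corners

/-! ## §3 At the display: every corner of every admissible plaquette lies in `Λ_{k+1}` of the history -/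

section Display

variable (F : T4Family) (ν : Stage7Numerics) (M : ℕ) (p : B12.RunParams) (g : ℕ → ℝ)

/-- ★★★ **ADMISSIBLE `X` LIVE IN THE NEW SMALL-FIELD REGION.**  Let the regularity regions `R (k+1) c″` (level-`(k+2)` plaquettes) sit within `r` χ_{k+2}-layers of
`c″` on the fine torus (LOCALITY letter at level `k+1`), `0 < M`, `k + 1 ≤ m + K`, and the budget `(r+1)·sideχ (k+1) + L^{k+1}·(ρ+1) ≤ 4·sideD (k+1) + 1` hold.  Then for
every history `h : Fin (k+1) → LabelPat`, every `D ⊆ cubes32 (k+1) (seqOfHist (k+1) h)` and every `X` with `∀ q ∈ X, ∃ c″ ∈ D, ∃ p′ ∈ R (k+1) c″, q ∈ boxRegion (emb p′.src) ρ`: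
the fine position of EVERY CORNER of every `q ∈ X` lies in `(seqOfHist (k+1) h).Λ (k+1)`. [cite: Balaban1988Convergent, p.258 («𝐓_k is supported in Z_k»), (3.2)–(3.5) p.264–265, (3.20) p.269] -/
theorem corners_mem_Λ_labelAt (hM : 0 < M) {k : ℕ} (hk : k + 1 ≤ (F.P p.K).m + (F.P p.K).K)
    (R'' : Iχ F ν p g (k + 1) → Finset (Plaq (F.P p.K) (k + 2))) {r ρ : ℕ}
    (hR'' : ∀ (c'' : Iχ F ν p g (k + 1)), ∀ p' ∈ R'' c'', embIter (k + 2) p'.src ∈ cubeEnl (F.P p.K) (sideχ F ν p g (k + 1)) c'' r)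
    (hbud : (r + 1) * sideχ F ν p g (k + 1) + (F.P p.K).L ^ (k + 1) * (ρ + 1) ≤ 4 * sideD F ν M p g (k + 1) + 1)
    (h : Fin (k + 1) → LabelPat F ν p g)
    {D : Finset (Iχ F ν p g (k + 1))} (hD : D ⊆ cubes32 F ν M p g (k + 1) (seqOfHist F ν M p g (k + 1) h))
    {X : Finset (Plaq (F.P p.K) (k + 1))} (hX : ∀ q ∈ X, ∃ c'' ∈ D, ∃ p' ∈ R'' c'', q ∈ boxRegion (emb p'.src) ρ)
    {q : Plaq (F.P p.K) (k + 1)} (hq : q ∈ X) {z : Site (F.P p.K) (k + 1)}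
    (hz : z = q.src ∨ z = q.src.shift q.μ ∨ z = q.src.shift q.ν ∨ z = (q.src.shift q.μ).shift q.ν) :
    embIter (k + 1) z ∈ (seqOfHist F ν M p g (k + 1) h).Λ (k + 1) := by
  obtain ⟨c'', hc''D, p', hp', hqb⟩ := hX q hq
  exact corner_mem_Λ_succ_of_mem_boxRegion F ν M p g hk (sideD_pos_of_pos F ν M p g hM (k + 1))
    (seqOfHist F ν M p g k (Fin.init h)) (labelAt F ν p g k (h (Fin.last k))) (hD hc''D) (hR'' c'' p' hp') hqb hbud hz

end Display

/-! ## §4 … hence in every small-field region `Λ_i` and every localization domain `Ω_i` of the history, `1 ≤ i ≤ k+1` -/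

section Chain

variable (F : T4Family) (ν : Stage7Numerics) (M : ℕ) (p : B12.RunParams) (g : ℕ → ℝ)

/-- ★★★ **ADMISSIBLE `X` LIVE IN THE ACCUMULATED SMALL-FIELD REGION OF THE WHOLE HISTORY**: with the hypotheses of `corners_mem_Λ_labelAt`, the fine position of every
corner of every `q ∈ X` lies in `(seqOfHist (k+1) h).Λ i` AND in `(seqOfHist (k+1) h).Ω i` for EVERY `1 ≤ i ≤ k + 1` — the (2.1)-chain
`Λ_{k+1} ⊆ Ω_{k+1} ⊆ Λ_k ⊆ ⋯ ⊆ Λ_1 ⊆ Ω_1` (n22-b's `Chain21.Λ_antitone`, `Λ_subset_Ω_of_le`).  The repaired display integrates plaquettes ONLY where the term carries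
no large-field operation at any level. [cite: Balaban1988Convergent, (2.1) p.254, p.258, (3.2)–(3.5) p.264–265; Balaban1989LargeFieldII, p.383 l.21–28] -/
theorem corners_mem_Λ_Ω_of_le (hM : 0 < M) {k : ℕ} (hk : k + 1 ≤ (F.P p.K).m + (F.P p.K).K)
    (R'' : Iχ F ν p g (k + 1) → Finset (Plaq (F.P p.K) (k + 2))) {r ρ : ℕ}
    (hR'' : ∀ (c'' : Iχ F ν p g (k + 1)), ∀ p' ∈ R'' c'', embIter (k + 2) p'.src ∈ cubeEnl (F.P p.K) (sideχ F ν p g (k + 1)) c'' r)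
    (hbud : (r + 1) * sideχ F ν p g (k + 1) + (F.P p.K).L ^ (k + 1) * (ρ + 1) ≤ 4 * sideD F ν M p g (k + 1) + 1)
    (h : Fin (k + 1) → LabelPat F ν p g)
    {D : Finset (Iχ F ν p g (k + 1))} (hD : D ⊆ cubes32 F ν M p g (k + 1) (seqOfHist F ν M p g (k + 1) h))
    {X : Finset (Plaq (F.P p.K) (k + 1))} (hX : ∀ q ∈ X, ∃ c'' ∈ D, ∃ p' ∈ R'' c'', q ∈ boxRegion (emb p'.src) ρ)
    {q : Plaq (F.P p.K) (k + 1)} (hq : q ∈ X) {z : Site (F.P p.K) (k + 1)}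
    (hz : z = q.src ∨ z = q.src.shift q.μ ∨ z = q.src.shift q.ν ∨ z = (q.src.shift q.μ).shift q.ν)
    {i : ℕ} (h1 : 1 ≤ i) (hi : i ≤ k + 1) :
    embIter (k + 1) z ∈ (seqOfHist F ν M p g (k + 1) h).Λ i ∧ embIter (k + 1) z ∈ (seqOfHist F ν M p g (k + 1) h).Ω i := by
  have hΛ := corners_mem_Λ_labelAt F ν M p g hM hk R'' hR'' hbud h hD hX hq hz
  exact ⟨(seqOfHist F ν M p g (k + 1) h).chain.Λ_antitone h1 hi le_rfl hΛ,
    (seqOfHist F ν M p g (k + 1) h).chain.Λ_subset_Ω_of_le h1 hi le_rfl hΛ⟩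

end Chain

end Summit.QuantumFields.YangMills.BalabanUVNodes.N20LCSHullInSmallField

end
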